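import Summits.QuantumFields.BalabanUV.T4Continuum.Spine.NE1p.B7AveragingAbelianSectorRemainder

/-!
# T⁴ programme, spine estimate NE1′ (node O3b/H2) — A FULLY ABELIAN SECTOR AT A GENERAL BACKGROUND: when the background `U₀ = e^{A₀}`
# and the perturbation `e^{A}` take jointly commuting values, THE BACKGROUND DROPS OUT of Bałaban's covariant one-step map (121) —
# `Q(U₀, A, c) = L(Q₀A)_c` exactly —, so Proposition 4's remainder `C_j(U₀, ·)` and every term `C_j⁽ⁿ⁾(U₀, ·)` of (136) vanish

Cell `pub-balaban-gaps` (YM blitz Y1, track G2), seat `ne1` gen 8 (prover-pub-balaban-gaps-ne1-g8-0); record `HOME/ne/NE1.md` v8 §4 R51.  ADDITIVE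
— imports this seat's `B7AveragingAbelianSectorRemainder` (files 1–2 of gen 8) ONLY; through it `B7Eq92Concrete` (`Rc` (56), `tHol` (58), `Fcov`∕`wframe`
(62)∕(82), `tild` (65), `dbavgCov` (89)), `B7Prop3GeneralLinear` (`Qcov` (121), `linQcov`∕`Ccov` (122)), `B7Prop4GeneralLevels` (`logCovIter`∕`linCovIter`
(127)), `B7Prop5GeneralInduction.CCovIter` (150), `B7Eq136SecondOrder.CCovIter2`, `B7Eq136Series.CCovIterN` (136),
`B7Prop4Flat.asum_sub` — consumed BY NAME (the displays are quoted verbatim in those modules), nothing edited or restated; NO new definition.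

WHY ∕ WHAT.  Files 1–2 treat the FLAT background; NE1.md v8 R49∕R50 leave «a non-flat background `U₀`» a READING, because there a one-parameter
perturbation interleaves with the background ((58): `(R_{0,y}V′)(Γ) = ∏ R(V₀(Γ_{y,b₋}))V′_b`).  THIS FILE isolates the interleaving: if the background's
values COMMUTE with the perturbation's and each family is abelian (abelian structure group; background and slot in one maximal torus ∕ one
one-parameter subgroup), every rotation `R(·)` of (56)–(58)∕(89) acts trivially — §1 the twisted transport (58) IS the transport of the perturbation
(`val_tHol_expCfg₂`), the frames (82) are the flat ones (`Fcov_expCfg₂`); §2 the background-removed average (65) is `Ṽ₁(c) = exp T_c(A)`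
(`val_tild_expCfg₂`), the double-bar average (89) is `exp(L(Q₀A)_c)` (`val_dbavgCov_expCfg₂`), hence **`Q(U₀, A, c) = L(Q₀A)_c` — THE BACKGROUND DROPS
OUT** (`Qcov_expCfg₂`, `linQcov_expCfg₂`, `Ccov_expCfg₂ : C(U₀, A, c) = 0`); §3 along the levels (127) the level backgrounds `Ū₀ʲ = e^{(rescale∘T)^{j}A₀}`
(file 1) stay in the commuting family, so `Q_j(U₀, B)` and `Lʲη·Q_j(U₀)B` BOTH equal the FLAT linear composite `linCovIter L 1 B j`
(`logCovIter_linCovIter_expCfg₂`): **`C_j(U₀, B)(c) = 0`** (`CCovIter_expCfg₂_eq_zero`) and **`C_j⁽ⁿ⁾(U₀, B)(c) = 0` for every `n`**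
(`CCovIterN_expCfg₂_eq_zero`).  So the curvature channel of NE1′ (R46–R48) is a PURELY NON-ABELIAN effect: what survives at a general background is made
of commutators [slot, background] and [bond, bond′] only.  Classification of NE1′ UNCHANGED: WORK-bound ∕ OBJECT-bound ∕ NOT idea-bound.

HONEST FRAMING.  [folklore] identities (`exp` of commuting elements, `log ∘ exp = id` on the printed radius, trivial conjugation action on commuting units,
finite sums, `iteratedDeriv` of an eventually-zero function) over an ABSTRACT complete normed ℂ-algebra and the lineages' `ℤᵈ` model; the smallness
hypotheses (sup bound `M` on the field, `2(d+1)·Lʲ·M` plus the background's level-`i` loop sums below `ln 2`) are a MODEL regime, not Bałaban's regularity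
(52); nothing of his is asserted beyond the SHAPE of the displays as typed; no density, R-operation, slot or background of his run is constructed; NE1′ NOT
proved; spine 0∕9; (B) 0∕13; binders 0∕6; one fixed finite T⁴ — NOT ℝ⁴, NOT infinite volume, NOT a mass gap, NOT Clay.  0 sorry.
-/


noncomputable section

open scoped BigOperators Topology
open NormedSpace Finset Filter
namespace Summit.QuantumFields.BalabanUV.T4Continuum.NE1p.B7AveragingAbelianSector

open Literature.MathematicalPhysics.QuantumFieldTheory.Balaban1983to89.B7Prop1Explicit
open Literature.MathematicalPhysics.QuantumFieldTheory.Balaban1983to89.B7Prop3Flat (expCfg asum_csmul Favg vframe dbavg Fhat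
  linQ frame_cancellation linQ_csmul)
open Literature.MathematicalPhysics.QuantumFieldTheory.Balaban1983to89.B7Prop4Flat (asum_sub)
open Literature.MathematicalPhysics.QuantumFieldTheory.Balaban1983to89.B7Prop4GeneralLevels (logCovIter linCovIter
  logCovIter_succ linCovIter_succ logCovIter_zero linCovIter_zero)
open Literature.MathematicalPhysics.QuantumFieldTheory.Balaban1983to89.B7Prop3GeneralLinear (Qcov linQcov Ccov)
open Literature.MathematicalPhysics.QuantumFieldTheory.Balaban1983to89.B7Prop5GeneralInduction (CCovIter)
open Literature.MathematicalPhysics.QuantumFieldTheory.Balaban1983to89.B7Eq136SecondOrder (CCovIter2 CCovIter2_def)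
open Literature.MathematicalPhysics.QuantumFieldTheory.Balaban1983to89.B7Eq136Series (CCovIterN CCovIterN_def)
open Literature.MathematicalPhysics.QuantumFieldTheory.Balaban1983to89.B7Eq92Concrete (Rc Rc_apply tHol Fcov wframe tild dbavgCov
  tild_apply dbavgCov_apply)
open Literature.MathematicalPhysics.QuantumFieldTheory.Balaban1983to89.B7Prop2Explicit (avgIter rescale avgIter_succ)
open Literature.MathematicalPhysics.QuantumFieldTheory.Balaban1983to89.B7BlockAvgLog (mlog_exp)
open Literature.MathematicalPhysics.QuantumFieldTheory.Balaban1983to89.MatrixLog (mlog)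
open Literature.Analysis.Complex (mem_eball_expSeries_radius)

variable {d : ℕ} {𝔸 : Type*} [NormedRing 𝔸] [NormedAlgebra ℂ 𝔸] [CompleteSpace 𝔸] {A₀ A B : Site d → Fin d → 𝔸} {L : ℕ}

/-! ## §1 Two jointly commuting bond fields: the product configuration, the twisted transport (58), the frames (82) -/

omit [NormedAlgebra ℂ 𝔸] [CompleteSpace 𝔸] in
/-- `A(Γ)` is additive in the field (from `B7Prop4Flat.asum_sub`). [folklore] -/
theorem asum_add (A A₀ : Site d → Fin d → 𝔸) (x : Site d) (w : List (Letter d)) :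
    asum (A + A₀) x w = asum A x w + asum A₀ x w := by
  have h := asum_sub (A + A₀) A₀ x w
  rw [add_sub_cancel_right] at h
  rw [← sub_eq_iff_eq_add, ← h]

omit [CompleteSpace 𝔸] in
/-- `T_c` is additive in the field. [folklore] -/
theorem Tside_add (L : ℕ) (A A₀ : Site d → Fin d → 𝔸) (q : Site d) (κ : Fin d) :
    Tside L (A + A₀) q κ = Tside L A q κ + Tside L A₀ q κ := by
  simp only [Tside, asum_add, smul_add, Finset.sum_add_distrib]

omit [NormedAlgebra ℂ 𝔸] [CompleteSpace 𝔸] in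
/-- The sum of two jointly commuting abelian fields is abelian. [folklore] -/
theorem commute_add_add (hA : ∀ x κ y μ, Commute (A x κ) (A y μ)) (h₀ : ∀ x κ y μ, Commute (A₀ x κ) (A₀ y μ))
    (hx : ∀ x κ y μ, Commute (A x κ) (A₀ y μ)) :
    ∀ x κ y μ, Commute ((A + A₀) x κ) ((A + A₀) y μ) := fun x κ y μ =>
  ((hA x κ y μ).add_right (hx x κ y μ)).add_left ((hx y μ x κ).symm.add_right (h₀ x κ y μ))

/-- Bondwise, `e^{A}·e^{A₀} = e^{A + A₀}` when the two values commute: the product configuration `V₁V₀` of (58)∕(65) is the exponential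
configuration of the sum. [cite: Balaban1985Averaging, (58) p.27, (65) p.29, (109) p.34] -/
theorem expCfg_mul_expCfg (hx : ∀ x κ, Commute (A x κ) (A₀ x κ)) : expCfg A * expCfg A₀ = expCfg (A + A₀) := by
  funext x κ
  refine Units.ext ?_
  show exp (A x κ) * exp (A₀ x κ) = exp ((A + A₀) x κ)
  rw [Pi.add_apply, Pi.add_apply,
    exp_add_of_commute_of_mem_ball (hx x κ) (mem_eball_expSeries_radius _) (mem_eball_expSeries_radius _)]

/-- **THE TWISTED TRANSPORT (58) IN A FULLY ABELIAN SECTOR IS THE TRANSPORT OF THE PERTURBATION**: `(R_{0,y}e^{A})(Γ) =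
(e^{A}e^{A₀})(Γ)·e^{A₀}(Γ)⁻¹ = exp A(Γ)` — every rotation `R(V₀(Γ_{y,b₋}))` acts trivially. [cite: Balaban1985Averaging, (58) p.27] -/
theorem val_tHol_expCfg₂ (hA : ∀ x κ y μ, Commute (A x κ) (A y μ)) (h₀ : ∀ x κ y μ, Commute (A₀ x κ) (A₀ y μ))
    (hx : ∀ x κ y μ, Commute (A x κ) (A₀ y μ)) (y : Site d) (w : List (Letter d)) :
    ((tHol (expCfg A₀) (expCfg A) y w : 𝔸ˣ) : 𝔸) = exp (asum A y w) := by
  have hw : ((hol (expCfg A₀) y w : 𝔸ˣ) : 𝔸) = exp (asum A₀ y w) := val_hol_expCfg h₀ w y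
  show (((hol (expCfg A * expCfg A₀) y w * (hol (expCfg A₀) y w)⁻¹ : 𝔸ˣ)) : 𝔸) = _
  rw [Units.val_mul, units_val_inv_eq_exp_neg hw, expCfg_mul_expCfg (fun x κ => hx x κ x κ),
    val_hol_expCfg (commute_add_add hA h₀ hx) w y, asum_add,
    ← exp_add_of_commute_of_mem_ball (((commute_asum_asum hx w y y w).add_left
        (commute_asum_asum h₀ w y y w)).neg_right) (mem_eball_expSeries_radius _) (mem_eball_expSeries_radius _),
    add_neg_cancel_right]

/-- The frame exponent (62)∕(82) at the abelian background is the flat linearised frame: `F_{U₀}(y) = F̂(y)` (tree sums of `A` inside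
the logarithm radius). [cite: Balaban1985Averaging, (62) p.28, (82) p.30, (112) p.34] -/
theorem Fcov_expCfg₂ (hA : ∀ x κ y μ, Commute (A x κ) (A y μ)) (h₀ : ∀ x κ y μ, Commute (A₀ x κ) (A₀ y μ))
    (hx : ∀ x κ y μ, Commute (A x κ) (A₀ y μ)) (q : Site d)
    (hF : ∀ r : Fin d → Fin L, ‖asum A q (treeWord (boxVec L r))‖ < Real.log 2) :
    Fcov L (expCfg A₀) (expCfg A) q = Fhat L A q := by
  unfold Fcov Fhat
  exact Finset.sum_congr rfl fun r _ => by rw [val_tHol_expCfg₂ hA h₀ hx, mlog_exp (hF r)]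

/-- … so the block frame (82) is `exp F̂(y)` and its inverse `exp(−F̂(y))`. [cite: Balaban1985Averaging, (82) p.30] -/
theorem val_wframe_expCfg₂ (hA : ∀ x κ y μ, Commute (A x κ) (A y μ)) (h₀ : ∀ x κ y μ, Commute (A₀ x κ) (A₀ y μ))
    (hx : ∀ x κ y μ, Commute (A x κ) (A₀ y μ)) (q : Site d)
    (hF : ∀ r : Fin d → Fin L, ‖asum A q (treeWord (boxVec L r))‖ < Real.log 2) :
    ((wframe L (expCfg A₀) (expCfg A) q : 𝔸ˣ) : 𝔸) = exp (Fhat L A q) ∧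
      (((wframe L (expCfg A₀) (expCfg A) q)⁻¹ : 𝔸ˣ) : 𝔸) = exp (-Fhat L A q) := by
  have h1 : ((wframe L (expCfg A₀) (expCfg A) q : 𝔸ˣ) : 𝔸) = exp (Fhat L A q) := by
    show ((expUnit (Fcov L (expCfg A₀) (expCfg A) q) : 𝔸ˣ) : 𝔸) = _
    rw [val_expUnit, Fcov_expCfg₂ hA h₀ hx q hF]
  exact ⟨h1, units_val_inv_eq_exp_neg h1⟩


/-! ## §2 The background-removed average (65), the double-bar average (89) and the one-step map (121): the background drops out -/

/-- **(65) IN A FULLY ABELIAN SECTOR: `Ṽ₁(c) = (\overline{e^{A}e^{A₀}})_c (\overline{e^{A₀}})_c⁻¹ = exp T_c(A + A₀)·exp(−T_c(A₀)) = exp T_c(A)`**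
(loop sums of `A + A₀` and of `A₀` at the bond inside the logarithm radius). [cite: Balaban1985Averaging, (65) p.29, (42) p.23] -/
theorem val_tild_expCfg₂ (hA : ∀ x κ y μ, Commute (A x κ) (A y μ)) (h₀ : ∀ x κ y μ, Commute (A₀ x κ) (A₀ y μ))
    (hx : ∀ x κ y μ, Commute (A x κ) (A₀ y μ)) (hL : 1 ≤ L) (q : Site d) (κ : Fin d)
    (hγ : ∀ r : Fin d → Fin L, ‖asum (A + A₀) q (gammaWord L κ (boxVec L r) ++ seg κ (-(L : ℤ)))‖ < Real.log 2)
    (hγ₀ : ∀ r : Fin d → Fin L, ‖asum A₀ q (gammaWord L κ (boxVec L r) ++ seg κ (-(L : ℤ)))‖ < Real.log 2) :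
    ((tild L (expCfg A₀) (expCfg A) q κ : 𝔸ˣ) : 𝔸) = exp (Tside L A q κ) := by
  have hb₀ : ((bavg L (expCfg A₀) q κ : 𝔸ˣ) : 𝔸) = exp (Tside L A₀ q κ) := val_bavg_expCfg h₀ hL q κ hγ₀
  have hAA₀ : Commute (Tside L A q κ) (Tside L A₀ q κ) :=
    (commute_Tside_of (fun x w => (commute_Tside_of (fun x' w' => commute_asum_asum hx w x x' w') L q κ).symm) L q κ).symm
  have c : Commute (Tside L A q κ + Tside L A₀ q κ) (-Tside L A₀ q κ) :=
    (hAA₀.add_left (commute_Tside h₀ L q κ q κ)).neg_right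
  rw [tild_apply, Units.val_mul, units_val_inv_eq_exp_neg hb₀, expCfg_mul_expCfg (fun x κ => hx x κ x κ),
    val_bavg_expCfg (commute_add_add hA h₀ hx) hL q κ hγ, Tside_add,
    ← exp_add_of_commute_of_mem_ball c (mem_eball_expSeries_radius _) (mem_eball_expSeries_radius _),
    add_neg_cancel_right]

/-- **(89) IN A FULLY ABELIAN SECTOR: `V̿₁(c) = exp(L·(Q₀A)_c)`** — the rotation `R̄_{0,c} = R((Ū₀)_c)` acts trivially on the frame at `c₊`,
and the flat frame cancellation (124) applies inside the exponential. [cite: Balaban1985Averaging, (89) p.31, (59) p.27, (124) p.36] -/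
theorem val_dbavgCov_expCfg₂ (hA : ∀ x κ y μ, Commute (A x κ) (A y μ)) (h₀ : ∀ x κ y μ, Commute (A₀ x κ) (A₀ y μ))
    (hx : ∀ x κ y μ, Commute (A x κ) (A₀ y μ)) (hL : 1 ≤ L) (q : Site d) (κ : Fin d)
    (hγ : ∀ r : Fin d → Fin L, ‖asum (A + A₀) q (gammaWord L κ (boxVec L r) ++ seg κ (-(L : ℤ)))‖ < Real.log 2)
    (hγ₀ : ∀ r : Fin d → Fin L, ‖asum A₀ q (gammaWord L κ (boxVec L r) ++ seg κ (-(L : ℤ)))‖ < Real.log 2)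
    (hF₁ : ∀ r : Fin d → Fin L, ‖asum A q (treeWord (boxVec L r))‖ < Real.log 2)
    (hF₂ : ∀ r : Fin d → Fin L, ‖asum A (q + (L : ℤ) • e κ) (treeWord (boxVec L r))‖ < Real.log 2) :
    ((dbavgCov L (expCfg A₀) (expCfg A) q κ : 𝔸ˣ) : 𝔸) = exp (linQ L A q κ) := by
  have hb₀ : ((bavg L (expCfg A₀) q κ : 𝔸ˣ) : 𝔸) = exp (Tside L A₀ q κ) := val_bavg_expCfg h₀ hL q κ hγ₀
  obtain ⟨hw₂, -⟩ := val_wframe_expCfg₂ hA h₀ hx (q + (L : ℤ) • e κ) hF₂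
  obtain ⟨-, hw₁⟩ := val_wframe_expCfg₂ hA h₀ hx q hF₁
  -- the rotation by `(Ū₀)_c` fixes the frame at `c₊`: both are exponentials of commuting elements
  have hTF : Commute (Tside L A₀ q κ) (Fhat L A (q + (L : ℤ) • e κ)) :=
    commute_Fhat_of (fun x w => (commute_Tside_of (fun x' w' => commute_asum_asum hx w x x' w') L q κ).symm) L _
  have hcomm : Commute (bavg L (expCfg A₀) q κ) (wframe L (expCfg A₀) (expCfg A) (q + (L : ℤ) • e κ)) := by
    refine Commute.units_of_val ?_
    rw [hb₀, hw₂]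
    exact hTF.exp_right.exp_left
  have hRc : Rc (bavg L (expCfg A₀) q κ) (wframe L (expCfg A₀) (expCfg A) (q + (L : ℤ) • e κ))
      = wframe L (expCfg A₀) (expCfg A) (q + (L : ℤ) • e κ) := by
    rw [Rc_apply, hcomm.eq, mul_inv_cancel_right]
  have c1 : Commute (-Fhat L A q) (Tside L A q κ) :=
    (commute_Tside_of (fun x w => commute_Fhat_asum hA L q x w) L q κ).neg_left
  have c2 : Commute (-Fhat L A q + Tside L A q κ) (Fhat L A (q + (L : ℤ) • e κ)) :=
    Commute.add_left (commute_Fhat_of (fun x w => commute_Fhat_asum hA L q x w) L _).neg_left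
      (commute_Fhat_of (fun x w => (commute_Tside_of (fun x' w' => commute_asum_asum hA w x x' w') L q κ).symm) L _)
  rw [dbavgCov_apply, hRc, Units.val_mul, Units.val_mul, hw₁, val_tild_expCfg₂ hA h₀ hx hL q κ hγ hγ₀, hw₂,
    ← exp_add_of_commute_of_mem_ball c1 (mem_eball_expSeries_radius _) (mem_eball_expSeries_radius _),
    ← exp_add_of_commute_of_mem_ball c2 (mem_eball_expSeries_radius _) (mem_eball_expSeries_radius _),
    frame_cancellation]

/-- **THE BACKGROUND DROPS OUT OF (121): `Q(U₀, A, c) = L(Q₀A)_c`** in a fully abelian sector (all smallness conditions at the bond).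
[cite: Balaban1985Averaging, (121)–(122) p.36, (125) p.36] -/
theorem Qcov_expCfg₂ (hA : ∀ x κ y μ, Commute (A x κ) (A y μ)) (h₀ : ∀ x κ y μ, Commute (A₀ x κ) (A₀ y μ))
    (hx : ∀ x κ y μ, Commute (A x κ) (A₀ y μ)) (hL : 1 ≤ L) (q : Site d) (κ : Fin d)
    (hγ : ∀ r : Fin d → Fin L, ‖asum (A + A₀) q (gammaWord L κ (boxVec L r) ++ seg κ (-(L : ℤ)))‖ < Real.log 2)
    (hγ₀ : ∀ r : Fin d → Fin L, ‖asum A₀ q (gammaWord L κ (boxVec L r) ++ seg κ (-(L : ℤ)))‖ < Real.log 2)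
    (hF₁ : ∀ r : Fin d → Fin L, ‖asum A q (treeWord (boxVec L r))‖ < Real.log 2)
    (hF₂ : ∀ r : Fin d → Fin L, ‖asum A (q + (L : ℤ) • e κ) (treeWord (boxVec L r))‖ < Real.log 2)
    (hQ : ‖linQ L A q κ‖ < Real.log 2) :
    Qcov L (expCfg A₀) A q κ = linQ L A q κ := by
  show mlog ((dbavgCov L (expCfg A₀) (expCfg A) q κ : 𝔸ˣ) : 𝔸) = _
  rw [val_dbavgCov_expCfg₂ hA h₀ hx hL q κ hγ hγ₀ hF₁ hF₂, mlog_exp hQ]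

omit [CompleteSpace 𝔸] in
/-- Along the ray `tA` at a FIXED abelian background whose loop sums at the bond are inside the radius, all smallness conditions hold for
`t` near `0`. [folklore] -/
theorem eventually_oneStep_small₂ (A₀ A : Site d → Fin d → 𝔸) (L : ℕ) (q : Site d) (κ : Fin d)
    (hγ₀ : ∀ r : Fin d → Fin L, ‖asum A₀ q (gammaWord L κ (boxVec L r) ++ seg κ (-(L : ℤ)))‖ < Real.log 2) :
    ∀ᶠ t : ℂ in 𝓝 0,
      (∀ r : Fin d → Fin L, ‖asum (t • A + A₀) q (gammaWord L κ (boxVec L r) ++ seg κ (-(L : ℤ)))‖ < Real.log 2) ∧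
      (∀ r : Fin d → Fin L, ‖asum (t • A) q (treeWord (boxVec L r))‖ < Real.log 2) ∧
      (∀ r : Fin d → Fin L, ‖asum (t • A) (q + (L : ℤ) • e κ) (treeWord (boxVec L r))‖ < Real.log 2) ∧
      ‖linQ L (t • A) q κ‖ < Real.log 2 := by
  have h2 : (0 : ℝ) < Real.log 2 := Real.log_pos one_lt_two
  have key : ∀ X Y : 𝔸, ‖Y‖ < Real.log 2 → ∀ᶠ t : ℂ in 𝓝 0, ‖t • X + Y‖ < Real.log 2 := fun X Y hY => by
    have hc : Continuous fun t : ℂ => ‖t • X + Y‖ := ((continuous_id.smul continuous_const).add continuous_const).norm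
    exact (isOpen_lt hc continuous_const).mem_nhds (by simpa using hY)
  have key0 : ∀ X : 𝔸, ∀ᶠ t : ℂ in 𝓝 0, ‖t • X‖ < Real.log 2 := fun X => by simpa using key X 0 (by simpa using h2)
  refine ((Filter.eventually_all.2 fun r => ?_).and ((Filter.eventually_all.2 fun r => ?_).and
    ((Filter.eventually_all.2 fun r => ?_).and ?_)))
  · simpa only [asum_add, asum_csmul] using key (asum A q (gammaWord L κ (boxVec L r) ++ seg κ (-(L : ℤ)))) _ (hγ₀ r)
  · simpa only [asum_csmul] using key0 (asum A q (treeWord (boxVec L r)))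
  · simpa only [asum_csmul] using key0 (asum A (q + (L : ℤ) • e κ) (treeWord (boxVec L r)))
  · simpa only [linQ_csmul] using key0 (linQ L A q κ)

/-- **The linear part (122) at the abelian background IS the flat one: `L(Q(U₀)A)_c = L(Q₀A)_c`** (the derivative form; only the
background's loop sums at the bond need to be inside the radius). [cite: Balaban1985Averaging, (122) p.36] -/
theorem linQcov_expCfg₂ (hA : ∀ x κ y μ, Commute (A x κ) (A y μ)) (h₀ : ∀ x κ y μ, Commute (A₀ x κ) (A₀ y μ))
    (hx : ∀ x κ y μ, Commute (A x κ) (A₀ y μ)) (hL : 1 ≤ L) (q : Site d) (κ : Fin d)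
    (hγ₀ : ∀ r : Fin d → Fin L, ‖asum A₀ q (gammaWord L κ (boxVec L r) ++ seg κ (-(L : ℤ)))‖ < Real.log 2) :
    linQcov L (expCfg A₀) A q κ = linQ L A q κ := by
  have hev : (fun t : ℂ => Qcov L (expCfg A₀) (t • A) q κ) =ᶠ[𝓝 0] fun t => t • linQ L A q κ :=
    (eventually_oneStep_small₂ A₀ A L q κ hγ₀).mono fun t ht => by
      show Qcov L (expCfg A₀) (t • A) q κ = t • linQ L A q κ
      rw [Qcov_expCfg₂ (commute_smul hA t) h₀ (fun x κ y μ => (hx x κ y μ).smul_left t) hL q κ ht.1 hγ₀ ht.2.1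
        ht.2.2.1 ht.2.2.2, linQ_csmul]
  show deriv (fun t : ℂ => Qcov L (expCfg A₀) (t • A) q κ) 0 = _
  rw [hev.deriv_eq]
  simpa using deriv_smul_const (f := linQ L A q κ) differentiableAt_id (x := (0 : ℂ))

/-- **`C(U₀, A, c) = 0`: the one-step remainder (122) vanishes in a fully abelian sector.** [cite: Balaban1985Averaging, (122)–(123) p.36] -/
theorem Ccov_expCfg₂ (hA : ∀ x κ y μ, Commute (A x κ) (A y μ)) (h₀ : ∀ x κ y μ, Commute (A₀ x κ) (A₀ y μ))
    (hx : ∀ x κ y μ, Commute (A x κ) (A₀ y μ)) (hL : 1 ≤ L) (q : Site d) (κ : Fin d)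
    (hγ : ∀ r : Fin d → Fin L, ‖asum (A + A₀) q (gammaWord L κ (boxVec L r) ++ seg κ (-(L : ℤ)))‖ < Real.log 2)
    (hγ₀ : ∀ r : Fin d → Fin L, ‖asum A₀ q (gammaWord L κ (boxVec L r) ++ seg κ (-(L : ℤ)))‖ < Real.log 2)
    (hF₁ : ∀ r : Fin d → Fin L, ‖asum A q (treeWord (boxVec L r))‖ < Real.log 2)
    (hF₂ : ∀ r : Fin d → Fin L, ‖asum A (q + (L : ℤ) • e κ) (treeWord (boxVec L r))‖ < Real.log 2)
    (hQ : ‖linQ L A q κ‖ < Real.log 2) :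
    Ccov L (expCfg A₀) A q κ = 0 := by
  show Qcov L (expCfg A₀) A q κ - linQcov L (expCfg A₀) A q κ = 0
  rw [Qcov_expCfg₂ hA h₀ hx hL q κ hγ hγ₀ hF₁ hF₂ hQ, linQcov_expCfg₂ hA h₀ hx hL q κ hγ₀, sub_self]


/-! ## §3 The composites (127) at the abelian background: level backgrounds stay in the family; `C_j(U₀, ·) = 0`, `C_j⁽ⁿ⁾(U₀, ·) = 0` -/

omit [CompleteSpace 𝔸] in
/-- cross-commutation is preserved by the linear maps: if the values of `X` commute with those of `Y`, so do the values of
`rescale (T X)` and of `z κ ↦ L(Q₀Y)_{⟨Lz, Lz+Le_κ⟩}`. [folklore] -/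
theorem commute_rescaleTside_linQ {X Y : Site d → Fin d → 𝔸} (hx : ∀ x κ y μ, Commute (X x κ) (Y y μ)) (L : ℕ)
    (x : Site d) (κ : Fin d) (y : Site d) (μ : Fin d) :
    Commute (rescale L (Tside L X) x κ) (linQ L Y ((L : ℤ) • y) μ) :=
  (commute_linQ_of (fun x' w' => (commute_Tside_of (fun x'' w'' => (commute_asum_asum hx w'' x'' x' w').symm) L _ _).symm)
    L _ _)

/-- Along the levels the background iterates `(rescale∘T)^{j}A₀` and the flat linear composites `linCovIter L 1 B j` keep mutually
commuting values. [folklore] -/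
theorem commute_levels (h₀ : ∀ x κ y μ, Commute (A₀ x κ) (A₀ y μ)) (hB : ∀ x κ y μ, Commute (B x κ) (B y μ))
    (hx : ∀ x κ y μ, Commute (A₀ x κ) (B y μ)) (hL : 1 ≤ L) :
    ∀ (j : ℕ) (x : Site d) (κ : Fin d) (y : Site d) (μ : Fin d),
      Commute (((fun X => rescale L (Tside L X))^[j] A₀) x κ) (linCovIter L (1 : Site d → Fin d → 𝔸ˣ) B j y μ)
  | 0 => by simpa using hx
  | j + 1 => by
    intro x κ y μ
    rw [Function.iterate_succ_apply', linCovIter_one_succ_of_commute hB hL]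
    exact commute_rescaleTside_linQ (commute_levels h₀ hB hx hL j) L x κ y μ

omit [NormedAlgebra ℂ 𝔸] [CompleteSpace 𝔸] in
/-- quantitative loop bound: `‖A(Γ_{c,x} ∪ (−c))‖ ≤ 2(d+1)L·sup‖A‖`. [cite: Balaban1985Averaging, (14) p.19] -/
theorem norm_asum_loop_le {X : Site d → Fin d → 𝔸} {a : ℝ} (ha : 0 ≤ a) (hX : ∀ x κ, ‖X x κ‖ ≤ a) (q : Site d) (κ : Fin d)
    (r : Fin d → Fin L) : ‖asum X q (gammaWord L κ (boxVec L r) ++ seg κ (-(L : ℤ)))‖ ≤ (2 * ((d : ℝ) + 1) * L) * a := by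
  set w := gammaWord L κ (boxVec L r) ++ seg κ (-(L : ℤ)) with hw
  have hlen : (w.length : ℝ) ≤ 2 * ((d : ℝ) + 1) * L := by
    have h1 : w.length = 2 * l1 (boxVec L r) + L + L := by
      rw [hw, List.length_append, length_gammaWord, length_seg, Int.natAbs_neg, Int.natAbs_natCast]
    have h3 : (w.length : ℝ) = 2 * (l1 (boxVec L r) : ℝ) + L + L := by rw [h1]; push_cast; ring
    have h4 : (l1 (boxVec L r) : ℝ) ≤ (d : ℝ) * L := by exact_mod_cast l1_boxVec_le L r
    rw [h3]; nlinarith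
  calc ‖asum X q w‖ ≤ (w.length : ℝ) * a := norm_asum_le X q w.length ha (fun x κ _ => hX x κ) w q (by simp [l1])
    _ ≤ (2 * ((d : ℝ) + 1) * L) * a := by gcongr

/-- **THE COMPOSITES (127) AT A FULLY ABELIAN BACKGROUND ARE THE FLAT LINEAR COMPOSITES — the background drops out at every level**: with a
sup bound `M` on `B`, `2(d+1)·Lʲ·M < ln 2`, and the background's level-`i` loop sums plus that budget below `ln 2` (`i < j`), both `Q_j(U₀, B)` and
`Lʲη·Q_j(U₀)B` equal `linCovIter L 1 B j`. [cite: Balaban1985Averaging, (127) p.37, p.38 (before (133)), (134) p.38] -/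
theorem logCovIter_linCovIter_expCfg₂ (h₀ : ∀ x κ y μ, Commute (A₀ x κ) (A₀ y μ)) (hB : ∀ x κ y μ, Commute (B x κ) (B y μ))
    (hx : ∀ x κ y μ, Commute (A₀ x κ) (B y μ)) (hL : 1 ≤ L) {M : ℝ} (hM0 : 0 ≤ M) (hM : ∀ x κ, ‖B x κ‖ ≤ M) :
    ∀ j : ℕ, 2 * ((d : ℝ) + 1) * (L : ℝ) ^ j * M < Real.log 2 →
      (∀ i < j, ∀ (q : Site d) (κ : Fin d) (r : Fin d → Fin L),
        ‖asum (((fun X => rescale L (Tside L X))^[i] A₀)) q (gammaWord L κ (boxVec L r) ++ seg κ (-(L : ℤ)))‖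
          + 2 * ((d : ℝ) + 1) * (L : ℝ) ^ j * M < Real.log 2) →
      logCovIter L (expCfg A₀) B j = linCovIter L (1 : Site d → Fin d → 𝔸ˣ) B j ∧
        linCovIter L (expCfg A₀) B j = linCovIter L (1 : Site d → Fin d → 𝔸ˣ) B j
  | 0, _, _ => by simp
  | j + 1, hrad, hbg => by
    have hL1 : (1 : ℝ) ≤ L := by exact_mod_cast hL
    have hL0 : (0 : ℝ) ≤ L := by positivity
    have hpow : (L : ℝ) ^ j ≤ (L : ℝ) ^ (j + 1) := pow_le_pow_right₀ hL1 (Nat.le_succ j)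
    have hbudget : 2 * ((d : ℝ) + 1) * (L : ℝ) ^ j * M ≤ 2 * ((d : ℝ) + 1) * (L : ℝ) ^ (j + 1) * M := by
      have hd : (0 : ℝ) ≤ 2 * ((d : ℝ) + 1) * M := by positivity
      nlinarith [mul_le_mul_of_nonneg_left hpow hd]
    have hbg' : ∀ i < j, ∀ (q : Site d) (κ : Fin d) (r : Fin d → Fin L),
        ‖asum (((fun X => rescale L (Tside L X))^[i] A₀)) q (gammaWord L κ (boxVec L r) ++ seg κ (-(L : ℤ)))‖
          + 2 * ((d : ℝ) + 1) * (L : ℝ) ^ j * M < Real.log 2 :=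
      fun i hi q κ r => lt_of_le_of_lt (by linarith [hbudget]) (hbg i (Nat.lt_succ_of_lt hi) q κ r)
    have hrad0 : 2 * ((d : ℝ) + 1) * (L : ℝ) ^ j * M < Real.log 2 := lt_of_le_of_lt hbudget hrad
    obtain ⟨ihlog, ihlin⟩ := logCovIter_linCovIter_expCfg₂ h₀ hB hx hL hM0 hM j hrad0 hbg'
    -- level-`j` data
    set X : Site d → Fin d → 𝔸 := (fun X => rescale L (Tside L X))^[j] A₀ with hXdef
    set Y : Site d → Fin d → 𝔸 := linCovIter L (1 : Site d → Fin d → 𝔸ˣ) B j with hYdef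
    have hXc : ∀ x κ y μ, Commute (X x κ) (X y μ) := commute_linIterate h₀ L j
    have hYc : ∀ x κ y μ, Commute (Y x κ) (Y y μ) := commute_linCovIter_one hB hL j
    have hYX : ∀ x κ y μ, Commute (Y x κ) (X y μ) := fun x κ y μ => (commute_levels h₀ hB hx hL j y μ x κ).symm
    have hbgX : ∀ i < j + 1, ∀ (q : Site d) (κ : Fin d) (r : Fin d → Fin L),
        ‖asum (((fun X => rescale L (Tside L X))^[i] A₀)) q (gammaWord L κ (boxVec L r) ++ seg κ (-(L : ℤ)))‖ < Real.log 2 :=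
      fun i hi q κ r => by
        have h := hbg i hi q κ r
        have : 0 ≤ 2 * ((d : ℝ) + 1) * (L : ℝ) ^ (j + 1) * M := by positivity
        linarith
    have hU : avgIter L (expCfg A₀) j = expCfg X := avgIter_expCfg h₀ hL j (fun i hi => hbgX i (Nat.lt_succ_of_lt hi))
    -- field-side smallness at level `j` from the sup bound `Lʲ·M`
    have hYn : ∀ x κ, ‖Y x κ‖ ≤ (L : ℝ) ^ j * M := norm_linCovIter_one_le hB hL hM0 hM j
    have hja : 0 ≤ (L : ℝ) ^ j * M := by positivity
    have hradj : (2 * ((d : ℝ) + 1) * L) * ((L : ℝ) ^ j * M) < Real.log 2 := by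
      calc (2 * ((d : ℝ) + 1) * L) * ((L : ℝ) ^ j * M) = 2 * ((d : ℝ) + 1) * (L : ℝ) ^ (j + 1) * M := by ring
        _ < Real.log 2 := hrad
    have hdL : ((d * L : ℕ) : ℝ) * ((L : ℝ) ^ j * M) ≤ (2 * ((d : ℝ) + 1) * L) * ((L : ℝ) ^ j * M) := by
      apply mul_le_mul_of_nonneg_right _ hja
      push_cast; nlinarith [(Nat.cast_nonneg d : (0 : ℝ) ≤ d)]
    have hLa : (L : ℝ) * ((L : ℝ) ^ j * M) ≤ (2 * ((d : ℝ) + 1) * L) * ((L : ℝ) ^ j * M) := by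
      apply mul_le_mul_of_nonneg_right _ hja
      nlinarith [(Nat.cast_nonneg d : (0 : ℝ) ≤ d)]
    have hYloop : ∀ (q : Site d) (κ : Fin d) (r : Fin d → Fin L),
        ‖asum (Y + X) q (gammaWord L κ (boxVec L r) ++ seg κ (-(L : ℤ)))‖ < Real.log 2 := fun q κ r => by
      rw [asum_add]
      refine (norm_add_le _ _).trans_lt ?_
      have h1 := norm_asum_loop_le hja hYn q κ r
      have h2 := hbg j (Nat.lt_succ_self j) q κ r
      have h3 : (2 * ((d : ℝ) + 1) * L) * ((L : ℝ) ^ j * M) = 2 * ((d : ℝ) + 1) * (L : ℝ) ^ (j + 1) * M := by ring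
      linarith
    constructor
    · funext z κ
      rw [logCovIter_succ, hU, ihlog, linCovIter_one_succ_of_commute hB hL]
      exact Qcov_expCfg₂ hYc hXc hYX hL _ κ (hYloop _ κ) (fun r => hbgX j (Nat.lt_succ_self j) _ κ r)
        (fun r => ((norm_asum_treeWord_le hja hYn _ r).trans hdL).trans_lt hradj)
        (fun r => ((norm_asum_treeWord_le hja hYn _ r).trans hdL).trans_lt hradj)
        (((norm_linQ_le_of_norm_le hL hja hYn _ κ).trans hLa).trans_lt hradj)
    · funext z κ
      rw [linCovIter_succ, hU, ihlin, linCovIter_one_succ_of_commute hB hL]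
      exact linQcov_expCfg₂ hYc hXc hYX hL _ κ (fun r => hbgX j (Nat.lt_succ_self j) _ κ r)

/-- **`C_j(U₀, B)(c) = 0`: Proposition 4's remainder (150)∕(134) VANISHES at a fully abelian background.** [cite: Balaban1985Averaging, (134) p.38, (150) p.40] -/
theorem CCovIter_expCfg₂_eq_zero (h₀ : ∀ x κ y μ, Commute (A₀ x κ) (A₀ y μ)) (hB : ∀ x κ y μ, Commute (B x κ) (B y μ))
    (hx : ∀ x κ y μ, Commute (A₀ x κ) (B y μ)) (hL : 1 ≤ L) {M : ℝ} (hM0 : 0 ≤ M) (hM : ∀ x κ, ‖B x κ‖ ≤ M) (j : ℕ)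
    (hrad : 2 * ((d : ℝ) + 1) * (L : ℝ) ^ j * M < Real.log 2)
    (hbg : ∀ i < j, ∀ (q : Site d) (κ : Fin d) (r : Fin d → Fin L),
        ‖asum (((fun X => rescale L (Tside L X))^[i] A₀)) q (gammaWord L κ (boxVec L r) ++ seg κ (-(L : ℤ)))‖
          + 2 * ((d : ℝ) + 1) * (L : ℝ) ^ j * M < Real.log 2) (z : Site d) (κ : Fin d) :
    CCovIter L (expCfg A₀) B j z κ = 0 := by
  obtain ⟨hlog, hlin⟩ := logCovIter_linCovIter_expCfg₂ h₀ hB hx hL hM0 hM j hrad hbg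
  show logCovIter L (expCfg A₀) B j z κ - linCovIter L (expCfg A₀) B j z κ = 0
  rw [hlog, hlin, sub_self]

/-- Along the ray `t ↦ tB` (background FIXED) the remainder is identically `0` for `t` near `0`. [cite: Balaban1985Averaging, (136)–(137) p.39] -/
theorem eventually_CCovIter_expCfg₂_smul_eq_zero (h₀ : ∀ x κ y μ, Commute (A₀ x κ) (A₀ y μ))
    (hB : ∀ x κ y μ, Commute (B x κ) (B y μ)) (hx : ∀ x κ y μ, Commute (A₀ x κ) (B y μ)) (hL : 1 ≤ L) {M : ℝ}
    (hM0 : 0 ≤ M) (hM : ∀ x κ, ‖B x κ‖ ≤ M) (j : ℕ)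
    (hrad : 2 * ((d : ℝ) + 1) * (L : ℝ) ^ j * M < Real.log 2)
    (hbg : ∀ i < j, ∀ (q : Site d) (κ : Fin d) (r : Fin d → Fin L),
        ‖asum (((fun X => rescale L (Tside L X))^[i] A₀)) q (gammaWord L κ (boxVec L r) ++ seg κ (-(L : ℤ)))‖
          + 2 * ((d : ℝ) + 1) * (L : ℝ) ^ j * M < Real.log 2) (z : Site d) (κ : Fin d) :
    ∀ᶠ t : ℂ in 𝓝 0, CCovIter L (expCfg A₀) (t • B) j z κ = 0 := by
  have hball : ∀ᶠ t : ℂ in 𝓝 0, ‖t‖ < 1 :=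
    Filter.eventually_of_mem (Metric.ball_mem_nhds (0 : ℂ) one_pos) fun t ht => by
      simpa [Metric.mem_ball, dist_zero_right] using ht
  refine hball.mono fun t ht => ?_
  have htM : ∀ x κ, ‖(t • B) x κ‖ ≤ ‖t‖ * M := fun x κ => by
    rw [Pi.smul_apply, Pi.smul_apply, norm_smul]; exact mul_le_mul_of_nonneg_left (hM x κ) (norm_nonneg _)
  have hle : 2 * ((d : ℝ) + 1) * (L : ℝ) ^ j * (‖t‖ * M) ≤ 2 * ((d : ℝ) + 1) * (L : ℝ) ^ j * M := by
    have hc : (0 : ℝ) ≤ 2 * ((d : ℝ) + 1) * (L : ℝ) ^ j := by positivity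
    have : ‖t‖ * M ≤ M := by nlinarith [norm_nonneg t]
    exact mul_le_mul_of_nonneg_left this hc
  refine CCovIter_expCfg₂_eq_zero h₀ (commute_smul hB t) (fun x κ y μ => (hx x κ y μ).smul_right t) hL
    (by positivity) htM j (by linarith) (fun i hi q κ' r => ?_) z κ
  have h := hbg i hi q κ' r
  linarith

/-- **EVERY HOMOGENEOUS TERM OF (136) VANISHES AT A FULLY ABELIAN BACKGROUND: `C_j⁽ⁿ⁾(U₀, B)(c) = 0` for all `n`** (in particular the
second-order term `C_j⁽²⁾(U₀, B)(c)`: no diagonal curvature of the composed averaging at an abelian background). [cite: Balaban1985Averaging, (136) p.39] -/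
theorem CCovIterN_expCfg₂_eq_zero (h₀ : ∀ x κ y μ, Commute (A₀ x κ) (A₀ y μ)) (hB : ∀ x κ y μ, Commute (B x κ) (B y μ))
    (hx : ∀ x κ y μ, Commute (A₀ x κ) (B y μ)) (hL : 1 ≤ L) {M : ℝ} (hM0 : 0 ≤ M) (hM : ∀ x κ, ‖B x κ‖ ≤ M) (j : ℕ)
    (hrad : 2 * ((d : ℝ) + 1) * (L : ℝ) ^ j * M < Real.log 2)
    (hbg : ∀ i < j, ∀ (q : Site d) (κ : Fin d) (r : Fin d → Fin L),
        ‖asum (((fun X => rescale L (Tside L X))^[i] A₀)) q (gammaWord L κ (boxVec L r) ++ seg κ (-(L : ℤ)))‖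
          + 2 * ((d : ℝ) + 1) * (L : ℝ) ^ j * M < Real.log 2) (z : Site d) (κ : Fin d) (n : ℕ) :
    CCovIterN L (expCfg A₀) B j z κ n = 0 ∧ CCovIter2 L (expCfg A₀) B j z κ = 0 := by
  have hev : (fun t : ℂ => CCovIter L (expCfg A₀) (t • B) j z κ) =ᶠ[𝓝 0] fun _ => (0 : 𝔸) :=
    eventually_CCovIter_expCfg₂_smul_eq_zero h₀ hB hx hL hM0 hM j hrad hbg z κ
  refine ⟨?_, ?_⟩
  · rw [CCovIterN_def, hev.iteratedDeriv_eq, iteratedDeriv_const]; simp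
  · rw [CCovIter2_def, hev.iteratedDeriv_eq, iteratedDeriv_const]; simp


end Summit.QuantumFields.BalabanUV.T4Continuum.NE1p.B7AveragingAbelianSector

end
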